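import Summits.ABC.ABC.Theses.PlacewiseSzpiro
import Summits.ABC.ABC.Theorems.PlacewiseSzpiroSingleTowerSzpiroStubPotentiallyGoodTowerOdd
import Summits.ABC.ABC.Theorems.PlacewiseSzpiroSingleTowerSzpiroStubPotentiallyGoodOrdTwo
import Summits.ABC.ABC.Theorems.PlacewiseSzpiroSingleTowerSzpiroStubTwistTransferOdd
import Summits.ABC.ABC.Theorems.PlacewiseSzpiroSingleTowerSzpiroStubTwistTransferTwo
import HarnessLib

/-!
# Crux `SingleTowerSzpiro` (stmt-ABC-22410) is EQUIVALENT to its multiplicative part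

`Summit.ABC.ABC.Theses.PlacewiseSzpiro.SingleTowerSzpiro` (every finite tower
`ord_v(Δ_min(E)) · log p_v ≤ (6+ε) log N_E + C(ε)`) holds if and only if it holds at the places of
MULTIPLICATIVE reduction (`f_v = 1`, where the tower is `−v_p(j_E) · log p`, one Tate parameter):

* `⇒` is specialisation;
* `⇐` is the kernel composition of line `birth` (Cruxes/SingleTowerSzpiro/Lines/birth.lean) over its four
  LANDED bookkeeping stubs: `stub_potentiallyGoodTowerOdd` (p577820), `stub_potentiallyGoodOrdTwo`
  (p578899, abc-harv-pr-4), `stub_twistTransferOdd` (p580133), `stub_twistTransferTwo` (p580442,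
  abc-harv-pr-4) — potentially good places are inside the budget with room (Tate's algorithm), and the
  additive potentially multiplicative places reduce to the multiplicative tower of the quadratic twist
  ramified exactly at `p`.

So the crux of route PlacewiseSzpiro is exactly the multiplicative-tower statement spelled out below — «one
Tate parameter against the global conductor». HONESTY: an equivalence of open statements; NOT progress on the
crux; abc is not proved by any of this; A1′ / A-PS are NOT abc; typed ≠ proved. No `sorry`, no new axiom, no
`def` (the multiplicative-tower statement is spelled out inline, verbatim the registered stub signature).
-/

noncomputable section

-- `Summit.<Summit>.<Problem>` is the mandated summit-side namespace (CONVENTIONS §2); for the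
-- single-conjunct summit `ABC` the two coincide, so the duplicate `ABC.ABC` is deliberate.
set_option linter.dupNamespace false

namespace Summit.ABC.ABC.Theorems.SingleTowerSzpiroLine

open IsDedekindDomain
open Summit.ABC.ABC.Theses.PlacewiseSzpiro

/-- **`SingleTowerSzpiro` from its multiplicative part** (the composition of line `birth` with its four
landed bookkeeping stubs): if every multiplicative tower obeys the `(6+ε) log N_E + C` budget, every tower
does. [folklore] -/
theorem singleTowerSzpiro_of_multiplicativeTower
    (h1 : ∀ ε : ℝ, 0 < ε → ∃ C : ℝ, ∀ (W : WeierstrassCurve ℚ) [W.IsElliptic]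
      (v : HeightOneSpectrum ℤ), W.conductorExponent v = 1 →
        (W.ordMinimalDiscriminant v : ℝ) * Real.log (Rat.HeightOneSpectrum.natGenerator v : ℝ) ≤
          (6 + ε) * Real.log (W.conductorNorm ℤ : ℝ) + C) :
    SingleTowerSzpiro := by
  intro ε hε
  obtain ⟨C₁, hC₁⟩ := h1 ε hε
  obtain ⟨C₂, hC₂⟩ := stub_potentiallyGoodTowerOdd
  obtain ⟨B, hB⟩ := stub_potentiallyGoodOrdTwo
  obtain ⟨C₄, hC₄⟩ := stub_twistTransferOdd h1 ε hε
  obtain ⟨C₅, hC₅⟩ := stub_twistTransferTwo h1 ε hε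
  refine ⟨max (max C₁ (max C₄ C₅)) (max C₂ ((B : ℝ) * Real.log 2)), fun W _ v => ?_⟩
  have hN1 : (1 : ℝ) ≤ (W.conductorNorm ℤ : ℝ) := by
    exact_mod_cast WeierstrassCurve.conductorNorm_pos_holds W
  have hlogN : 0 ≤ Real.log (W.conductorNorm ℤ : ℝ) := Real.log_nonneg hN1
  have hmax₁ : C₁ ≤ max (max C₁ (max C₄ C₅)) (max C₂ ((B : ℝ) * Real.log 2)) :=
    (le_max_left _ _).trans (le_max_left _ _)
  have hmax₄ : C₄ ≤ max (max C₁ (max C₄ C₅)) (max C₂ ((B : ℝ) * Real.log 2)) :=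
    ((le_max_left _ _).trans (le_max_right _ _)).trans (le_max_left _ _)
  have hmax₅ : C₅ ≤ max (max C₁ (max C₄ C₅)) (max C₂ ((B : ℝ) * Real.log 2)) :=
    ((le_max_right _ _).trans (le_max_right _ _)).trans (le_max_left _ _)
  have hmax₂ : C₂ ≤ max (max C₁ (max C₄ C₅)) (max C₂ ((B : ℝ) * Real.log 2)) :=
    (le_max_left _ _).trans (le_max_right _ _)
  have hmaxB : (B : ℝ) * Real.log 2 ≤ max (max C₁ (max C₄ C₅)) (max C₂ ((B : ℝ) * Real.log 2)) :=
    (le_max_right _ _).trans (le_max_right _ _)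
  by_cases hf : W.conductorExponent v = 1
  · exact (hC₁ W v hf).trans (by linarith)
  by_cases hj : v.valuation ℚ W.j ≤ 1
  · by_cases hp : Rat.HeightOneSpectrum.natGenerator v = 2
    · have hb : (W.ordMinimalDiscriminant v : ℝ) ≤ B := by exact_mod_cast hB W v hp hj
      have hlog2 : (0 : ℝ) ≤ Real.log 2 := Real.log_nonneg one_le_two
      rw [hp, Nat.cast_ofNat]
      have h6 : 0 ≤ (6 + ε) * Real.log (W.conductorNorm ℤ : ℝ) := by positivity
      nlinarith [hb, hlog2, hmaxB, h6]
    · have h := hC₂ W v hp hj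
      nlinarith [h, hlogN, hmax₂, hε]
  · by_cases hp : Rat.HeightOneSpectrum.natGenerator v = 2
    · exact (hC₅ W v hp hf (not_le.mp hj)).trans (by linarith)
    · exact (hC₄ W v hp hf (not_le.mp hj)).trans (by linarith)

/-- **The crux is its multiplicative part**: `SingleTowerSzpiro` holds iff the multiplicative towers
(`f_v = 1`; there `ord_v(Δ_min) = −v_p(j_E)`, the order of the Tate parameter) obey the budget. [folklore] -/
theorem singleTowerSzpiro_iff_multiplicativeTower :
    SingleTowerSzpiro ↔
      (∀ ε : ℝ, 0 < ε → ∃ C : ℝ, ∀ (W : WeierstrassCurve ℚ) [W.IsElliptic]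
        (v : HeightOneSpectrum ℤ), W.conductorExponent v = 1 →
          (W.ordMinimalDiscriminant v : ℝ) * Real.log (Rat.HeightOneSpectrum.natGenerator v : ℝ) ≤
            (6 + ε) * Real.log (W.conductorNorm ℤ : ℝ) + C) :=
  ⟨fun h ε hε => by
    obtain ⟨C, hC⟩ := h ε hε
    exact ⟨C, fun W _ v _ => hC W v⟩,
   singleTowerSzpiro_of_multiplicativeTower⟩

end Summit.ABC.ABC.Theorems.SingleTowerSzpiroLine

end
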